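import Summits.CriticalPhenomena.PercolationContinuityZ3.Theses.PercLowPointHalfSpace
import Summits.CriticalPhenomena.PercolationContinuityZ3.Theorems.PercLowPointHalfSpaceHalfSpaceAxisDecay
import Literature.Probability.Percolation.ClusterExplorationDecoupling

/-!
# Crux `PercLowPointHalfSpace.BoundaryTwoArmDecay` (stmt-CriticalPhenomena-0911), line `Sketch` — stub `stub_decoupling`

Helper file for the crux skeleton `Cruxes/BoundaryTwoArmDecay/Lines/Sketch.lean` (line
`exploration-decoupled-avoidance-split`, lead prover-line-stmt-CriticalPhenomena-0911-0). Proves EXACTLY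
the registered stub signature `stub_decoupling`; lands with `--supports stmt-CriticalPhenomena-0911`.
The general finite-volume tool (the exploration of a cluster is a stopping set; decoupling of the
unexplored pairs) is `Literature/Probability/Percolation/ClusterExplorationDecoupling.lean`.

## The statement (stopping-set decoupling of the exploration of `C_ℍ(0)` at `p_c(ℤ³)`)

With `P = P_{p_c(ℤ³)}`, `ℍ = {x | 0 ≤ x 0}`, `e = (0,1,0) = Pi.single 1 1`, `A(ω) = C_ℍ(0) = {v | 0 ⟷ v in ℍ}`
and `arm_ℍ(z, r) = {z ⟷ some y at sup-distance ≥ r from z, in ℍ}`: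

  `P(arm_ℍ(0,r), arm_ℍ(e,r), 0 ↮_ℍ e) ≤ ∫ 1{arm_ℍ(0,r)}(ω) · P({ω' | e ⟷ distance r in ℍ ∖ A(ω)}[ω']) dP(ω)`

for every `r ≥ 1` (the guard is not used). Equality holds; only `≤` is registered.

## The argument (finite volume + two limits)

All steps but the last are general (`V` countable, any graph and parameter):

1. `ClusterExploration.measure_arm_avoid_eq_lintegral` (Literature): for a FINITE explored domain `S ∋ x`
   and a finite second domain `T`, the exploration of `C_S(ω) = {v | x ⟷ v in S}` is a stopping set, and
   the decoupling along it (`bond_real_mem_dataEvent_eq`) gives the identity with `S`, `T` in place of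
   `ℍ`, `ℍ` (equality).
2. `measure_arm_avoid_le_lintegral`: second domain `T n ↑ D` — the left events increase to the limit event
   (an open path is finite, `openConnIn_iUnion_of_monotone`; continuity from below
   `tendsto_measure_iUnion_atTop`), the integrands are dominated by the limit integrand (`openConnIn_mono`).
3. `measure_disjoint_arms_le_lintegral`: explored domain `S m ↑ D`, assuming `C_D(ω)` is a.s. finite. On the
   event `{x ⟷ P₁ in D, x' ⟷ P₂ in D, x ↮_D x'}` the open path from `x'` avoids `C_D(ω) ⊇ C_{S m}(ω)`
   (`pathIn_diff_of_forall`), so step 2 bounds the truncated left events; they increase to the full event.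
   On the right, `C_{S m}(ω) = C_D(ω)` for all large `m` whenever `C_D(ω)` is finite
   (`eventually_setOf_openConnIn_eq`), so the integrands — measurable as functions of the finitely many
   pairs of `S m` (`measurable_of_forall_inter_eq`) and bounded by `1` — converge a.e.; dominated
   convergence (`tendsto_lintegral_of_dominated_convergence`) and `le_of_tendsto_of_tendsto'` conclude.
4. `stub_decoupling`: `V = Site 3`, `D = ℍ`, `S m = ℍ ∩ B(m)`, `x = 0`, `x' = e`, `p = p_c(ℤ³)`; the a.s.
   finiteness of `C_ℍ(0)` is Barsky–Grimmett–Newman (Grimmett 1999 Thm. (7.35)), in tree as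
   `ae_finite_openClusterIn_halfSpace_criticalProbI` (+ `openConnIn_eq_openConnVia`).

Tree API used: `openConnIn_mono` (`RSW.lean`), `openConnIn_eq_openConnVia` (`ConstrainedClusters.lean`),
`DCT16.mem_openConnIn_iff_pathIn`, `DCT16.determinedBy_openConnIn` (`SharpnessDCTProofs.lean`), `box`,
`box_mono`, `zero_mem_box`, `iUnion_coe_box` (`ThermodynamicLimit.lean`).
-/

noncomputable section

namespace Summit.CriticalPhenomena.PercolationContinuityZ3.Theorems.BoundaryTwoArmDecay

open MeasureTheory Filter Topology
open scoped ENNReal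
open Literature.Probability.Percolation Literature.Probability.LatticeModels

namespace StubDecoupling

variable {V : Type*}

/-! ### Paths -/

/-- A path inside `A` all of whose initial segments end outside `B` is a path inside `A \ B`. -/
theorem pathIn_diff_of_forall {G : SimpleGraph V} {A B : Set V} {u v : V} (h : PathIn G A u v)
    (hB : ∀ w, PathIn G A u w → w ∉ B) : PathIn G (A \ B) u v := by
  obtain ⟨hu, hr⟩ := h
  refine ⟨⟨hu, hB u (PathIn.refl hu)⟩, ?_⟩
  induction hr with
  | refl => exact Relation.ReflTransGen.refl
  | @tail b c hub hbc ih => exact ih.tail ⟨hbc.1, hbc.2, hB c ⟨hu, hub.tail hbc⟩⟩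

/-- `{u ⟷ v in ⋃ₙ Dₙ} = ⋃ₙ {u ⟷ v in Dₙ}` for an increasing sequence of domains (an open path is
finite, so it lies in one `Dₙ`). -/
theorem openConnIn_iUnion_of_monotone {D : ℕ → Set V} (hD : Monotone D) (u v : V) :
    (openConnIn (⋃ n, D n) u v : Set (BondConfig V)) = ⋃ n, openConnIn (D n) u v := by
  ext ω
  simp only [Set.mem_iUnion, DCT16.mem_openConnIn_iff_pathIn]
  constructor
  · rintro ⟨hu, hr⟩
    induction hr with
    | refl =>
      obtain ⟨n, hn⟩ := Set.mem_iUnion.1 hu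
      exact ⟨n, PathIn.refl hn⟩
    | @tail b c _ hbc ih =>
      obtain ⟨n, hn⟩ := ih
      obtain ⟨k, hk⟩ := Set.mem_iUnion.1 hbc.2
      exact ⟨max n k, (hn.mono (hD (le_max_left n k))).tail hbc.1 (hD (le_max_right n k) hk)⟩
  · rintro ⟨n, hn⟩
    exact hn.mono (Set.subset_iUnion D n)

/-- `{x ⟷ w in D}` and `{x' ⟷ w in D}` together give `{x ⟷ x' in D}`. -/
theorem mem_openConnIn_of_mem_of_mem {D : Set V} {x x' w : V} {ω : BondConfig V}
    (h : ω ∈ openConnIn D x w) (h' : ω ∈ openConnIn D x' w) : ω ∈ openConnIn D x x' := by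
  obtain ⟨hx, hw, hr⟩ := h
  obtain ⟨hx', hw', hr'⟩ := h'
  exact ⟨hx, hx', hr.trans hr'.symm⟩

/-! ### Measurability of finitely determined functions -/

/-- A function of the configuration that only depends on the states of finitely many pairs is
measurable (whatever the target σ-algebra). -/
theorem measurable_of_forall_inter_eq {β : Type*} [MeasurableSpace β] (K : Finset (Sym2 V))
    {f : BondConfig V → β} (hf : ∀ ω ω' : BondConfig V, ω ∩ ↑K = ω' ∩ ↑K → f ω = f ω') :
    Measurable f := by
  intro T _
  refine DeterminedBy.measurableSet_of_finset (F := K) ?_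
  rw [determinedBy_iff]
  intro ω ω' h
  simp only [Set.mem_preimage, hf ω ω' h]

/-- The cluster of `x` inside a finite set `S` only depends on the pairs of `S`. -/
theorem setOf_openConnIn_eq_of_inter_eq (S : Finset V) (x : V) {ω ω' : BondConfig V}
    (h : ω ∩ ↑S.sym2 = ω' ∩ ↑S.sym2) :
    {v | ω ∈ openConnIn (↑S : Set V) x v} = {v | ω' ∈ openConnIn (↑S : Set V) x v} := by
  ext v
  exact (determinedBy_iff _ _).1
    (DCT16.determinedBy_openConnIn (↑S : Set V) x v (K := ↑S.sym2) (by rw [Finset.coe_sym2])) ω ω' h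

/-! ### Infinite second domain: `T n ↑ D` -/

/-- **Infinite domain for the avoiding arm.** For finite `S ∋ x` and finite sets `T n ↑ D`:
`P_p(C ∋ P₁-vertex, x' ⟷ P₂ in D ∖ C) ≤ ∫ 1{C(ω) ∋ P₁-vertex} · P_p(x' ⟷ P₂ in D ∖ C(ω)) dP_p(ω)`,
`C(ω) = {v | x ⟷ v in S}` (continuity of the measure along the increasing union on the left,
`measure_arm_avoid_eq_lintegral` at each level, monotonicity in the domain on the right). -/
theorem measure_arm_avoid_le_lintegral [Countable V] (Gr : SimpleGraph V) (p : unitInterval)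
    (S : Finset V) {x : V} (hx : x ∈ S) (x' : V) (P₁ P₂ : V → Prop) {T : ℕ → Finset V}
    (hT : Monotone T) {D : Set V} (hTD : ⋃ n, (↑(T n) : Set V) = D) :
    bondPercolation Gr p {ω | (∃ y, P₁ y ∧ ω ∈ openConnIn (↑S : Set V) x y) ∧
        ∃ y, P₂ y ∧ ω ∈ openConnIn (D \ {v | ω ∈ openConnIn (↑S : Set V) x v}) x' y} ≤
      ∫⁻ ω, {ω : BondConfig V | ∃ y, P₁ y ∧ ω ∈ openConnIn (↑S : Set V) x y}.indicator
            (fun _ => (1 : ℝ≥0∞)) ω *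
          bondPercolation Gr p {ω' | ∃ y, P₂ y ∧
            ω' ∈ openConnIn (D \ {v | ω ∈ openConnIn (↑S : Set V) x v}) x' y}
        ∂(bondPercolation Gr p) := by
  have hEv_mono : ∀ {R R' : Set V}, R ⊆ R' →
      {ω' : BondConfig V | ∃ y, P₂ y ∧ ω' ∈ openConnIn R x' y} ⊆
        {ω' | ∃ y, P₂ y ∧ ω' ∈ openConnIn R' x' y} :=
    fun h ω' ⟨y, hy, hω'⟩ => ⟨y, hy, openConnIn_mono h x' y hω'⟩
  have hTsub : ∀ n, (↑(T n) : Set V) ⊆ D := fun n =>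
    hTD ▸ Set.subset_iUnion (fun n => (↑(T n) : Set V)) n
  have hdiff_mono : ∀ W : Set V, Monotone fun n => (↑(T n) : Set V) \ W := fun W m n hmn =>
    Set.sdiff_subset_sdiff_left (Finset.coe_subset.2 (hT hmn))
  have hexh : ∀ (W : Set V) (ω' : BondConfig V) (y : V), ω' ∈ openConnIn (D \ W) x' y ↔
      ∃ n, ω' ∈ openConnIn (↑(T n) \ W) x' y := by
    intro W ω' y
    have h := openConnIn_iUnion_of_monotone (hdiff_mono W) x' y
    rw [← Set.iUnion_sdiff, hTD] at h
    rw [h, Set.mem_iUnion]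
  have hLHS : {ω : BondConfig V | (∃ y, P₁ y ∧ ω ∈ openConnIn (↑S : Set V) x y) ∧
      ∃ y, P₂ y ∧ ω ∈ openConnIn (D \ {v | ω ∈ openConnIn (↑S : Set V) x v}) x' y} =
      ⋃ n, {ω | (∃ y, P₁ y ∧ ω ∈ openConnIn (↑S : Set V) x y) ∧
        ∃ y, P₂ y ∧ ω ∈ openConnIn (↑(T n) \ {v | ω ∈ openConnIn (↑S : Set V) x v}) x' y} := by
    ext ω
    simp only [Set.mem_setOf_eq, Set.mem_iUnion, hexh]
    exact ⟨fun ⟨h1, y, hy, n, hn⟩ => ⟨n, h1, y, hy, hn⟩, fun ⟨n, h1, y, hy, hn⟩ => ⟨h1, y, hy, n, hn⟩⟩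
  have hmonoL : Monotone fun n => {ω : BondConfig V | (∃ y, P₁ y ∧ ω ∈ openConnIn (↑S : Set V) x y) ∧
      ∃ y, P₂ y ∧ ω ∈ openConnIn (↑(T n) \ {v | ω ∈ openConnIn (↑S : Set V) x v}) x' y} := by
    intro m n hmn ω hω
    exact ⟨hω.1, hEv_mono (hdiff_mono _ hmn) hω.2⟩
  rw [hLHS]
  refine le_of_tendsto' (tendsto_measure_iUnion_atTop hmonoL) fun n => ?_
  rw [Function.comp_apply, ClusterExploration.measure_arm_avoid_eq_lintegral Gr p S (T n) hx x' P₁ P₂]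
  refine lintegral_mono fun ω => ?_
  exact mul_le_mul_right (measure_mono (hEv_mono (Set.sdiff_subset_sdiff_left (hTsub n)))) _

/-! ### Infinite explored domain: `S m ↑ D`, for an almost surely finite cluster -/

/-- **Eventual stabilisation of the explored cluster.** If `C(ω) = {v | x ⟷ v in D}` is finite, the
clusters of `x` inside finite sets `S m ↑ D` eventually equal `C(ω)`. -/
theorem eventually_setOf_openConnIn_eq {S : ℕ → Finset V} (hS : Monotone S) {D : Set V}
    (hSD : ⋃ n, (↑(S n) : Set V) = D) (x : V) {ω : BondConfig V}
    (hfin : {v | ω ∈ openConnIn D x v}.Finite) :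
    ∀ᶠ m in atTop, {v | ω ∈ openConnIn (↑(S m) : Set V) x v} = {v | ω ∈ openConnIn D x v} := by
  have hsub : ∀ m, (↑(S m) : Set V) ⊆ D := fun m =>
    hSD ▸ Set.subset_iUnion (fun n => (↑(S n) : Set V)) m
  have hmono : Monotone fun n => (↑(S n) : Set V) := fun m n hmn => Finset.coe_subset.2 (hS hmn)
  have hpt : ∀ v ∈ {v | ω ∈ openConnIn D x v}, ∀ᶠ m in atTop,
      ω ∈ openConnIn (↑(S m) : Set V) x v := by
    intro v hv
    have hv' : ω ∈ openConnIn (⋃ n, (↑(S n) : Set V)) x v := by rwa [hSD]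
    rw [openConnIn_iUnion_of_monotone hmono, Set.mem_iUnion] at hv'
    obtain ⟨n, hn⟩ := hv'
    exact eventually_atTop.2 ⟨n, fun m hm => openConnIn_mono (hmono hm) x v hn⟩
  filter_upwards [(eventually_all_finite hfin).2 hpt] with m hm
  exact Set.Subset.antisymm (fun v hv => openConnIn_mono (hsub m) x v hv) fun v hv => hm v hv

/-- **Decoupling of two disjoint clusters in an infinite domain** (general form of the stub). Let
finite sets `S m ∋ x` increase to `D` and suppose the cluster `C(ω) = {v | x ⟷ v in D}` is
`P_p`-a.s. finite. Then
`P_p(x ⟷ P₁ in D, x' ⟷ P₂ in D, x ↮ x' in D) ≤ ∫ 1{x ⟷ P₁ in D}(ω) · P_p(x' ⟷ P₂ in D ∖ C(ω)) dP_p(ω)`: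
on the left event the arm of `x'` avoids `C(ω) ⊇ C_m(ω)` (the cluster inside `S m`), so
`measure_arm_avoid_le_lintegral` applies at every level `m`; as `m → ∞`, `C_m(ω) = C(ω)` eventually
for a.e. `ω` (`eventually_setOf_openConnIn_eq`) and dominated convergence (bound `1`) passes to the
limit in the integral, while the left events increase to the full event. -/
theorem measure_disjoint_arms_le_lintegral [Countable V] (Gr : SimpleGraph V) (p : unitInterval)
    {S : ℕ → Finset V} (hS : Monotone S) {D : Set V} (hSD : ⋃ n, (↑(S n) : Set V) = D) {x : V}
    (hx : ∀ n, x ∈ S n) (x' : V) (P₁ P₂ : V → Prop)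
    (hfin : ∀ᵐ ω ∂(bondPercolation Gr p), {v | ω ∈ openConnIn D x v}.Finite) :
    bondPercolation Gr p {ω | (∃ y, P₁ y ∧ ω ∈ openConnIn D x y) ∧
        (∃ y, P₂ y ∧ ω ∈ openConnIn D x' y) ∧ ω ∉ openConnIn D x x'} ≤
      ∫⁻ ω, {ω : BondConfig V | ∃ y, P₁ y ∧ ω ∈ openConnIn D x y}.indicator
            (fun _ => (1 : ℝ≥0∞)) ω *
          bondPercolation Gr p {ω' | ∃ y, P₂ y ∧
            ω' ∈ openConnIn (D \ {v | ω ∈ openConnIn D x v}) x' y}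
        ∂(bondPercolation Gr p) := by
  set μ := bondPercolation Gr p with hμ
  have hsub : ∀ m, (↑(S m) : Set V) ⊆ D := fun m =>
    hSD ▸ Set.subset_iUnion (fun n => (↑(S n) : Set V)) m
  have hmonoS : Monotone fun n => (↑(S n) : Set V) := fun m n hmn => Finset.coe_subset.2 (hS hmn)
  -- the integrand as a function `Φ` of the explored cluster
  set Φ : Set V → ℝ≥0∞ := fun W => {W : Set V | ∃ y ∈ W, P₁ y}.indicator (fun _ => (1 : ℝ≥0∞)) W *
    μ {ω' | ∃ y, P₂ y ∧ ω' ∈ openConnIn (D \ W) x' y} with hΦ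
  have hΦ_le : ∀ W, Φ W ≤ 1 := fun W =>
    mul_le_one' (Set.indicator_apply_le' (fun _ => le_rfl) fun _ => zero_le_one) prob_le_one
  have hF : ∀ (R : Set V) (ω : BondConfig V),
      {ω : BondConfig V | ∃ y, P₁ y ∧ ω ∈ openConnIn R x y}.indicator (fun _ => (1 : ℝ≥0∞)) ω *
        μ {ω' | ∃ y, P₂ y ∧ ω' ∈ openConnIn (D \ {v | ω ∈ openConnIn R x v}) x' y} =
      Φ {v | ω ∈ openConnIn R x v} := by
    intro R ω
    simp only [hΦ]
    congr 1
    by_cases h : ∃ y, P₁ y ∧ ω ∈ openConnIn R x y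
    · rw [Set.indicator_of_mem (s := {ω : BondConfig V | ∃ y, P₁ y ∧ ω ∈ openConnIn R x y}) h,
        Set.indicator_of_mem (s := {W : Set V | ∃ y ∈ W, P₁ y})]
      obtain ⟨y, hy, hω⟩ := h
      exact ⟨y, hω, hy⟩
    · rw [Set.indicator_of_notMem (s := {ω : BondConfig V | ∃ y, P₁ y ∧ ω ∈ openConnIn R x y}) h,
        Set.indicator_of_notMem (s := {W : Set V | ∃ y ∈ W, P₁ y})]
      rintro ⟨y, hω, hy⟩
      exact h ⟨y, hy, hω⟩
  -- measurability of the finite-volume integrands (functions of the pairs of `S m`)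
  have hmeas : ∀ m, Measurable fun ω : BondConfig V =>
      Φ {v | ω ∈ openConnIn (↑(S m) : Set V) x v} := fun m =>
    measurable_of_forall_inter_eq (S m).sym2 fun ω ω' h => by
      rw [setOf_openConnIn_eq_of_inter_eq (S m) x h]
  -- almost sure convergence: the integrands are eventually constant
  have hlim : ∀ᵐ ω ∂μ, Tendsto (fun m => Φ {v | ω ∈ openConnIn (↑(S m) : Set V) x v}) atTop
      (𝓝 (Φ {v | ω ∈ openConnIn D x v})) := by
    filter_upwards [hfin] with ω hω
    refine tendsto_const_nhds.congr' ?_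
    filter_upwards [eventually_setOf_openConnIn_eq hS hSD x hω] with m hm
    rw [hm]
  have hR : Tendsto (fun m => ∫⁻ ω, Φ {v | ω ∈ openConnIn (↑(S m) : Set V) x v} ∂μ) atTop
      (𝓝 (∫⁻ ω, Φ {v | ω ∈ openConnIn D x v} ∂μ)) := by
    refine tendsto_lintegral_of_dominated_convergence (fun _ => 1) hmeas
      (fun m => Eventually.of_forall fun ω => hΦ_le _) ?_ hlim
    rw [lintegral_const, one_mul]
    exact measure_ne_top _ _
  -- the left event is the increasing union of its truncations by the finite-volume first arm
  set E : Set (BondConfig V) := {ω | (∃ y, P₁ y ∧ ω ∈ openConnIn D x y) ∧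
    (∃ y, P₂ y ∧ ω ∈ openConnIn D x' y) ∧ ω ∉ openConnIn D x x'} with hE
  have hEU : E = ⋃ m, E ∩ {ω | ∃ y, P₁ y ∧ ω ∈ openConnIn (↑(S m) : Set V) x y} := by
    ext ω
    simp only [Set.mem_iUnion, Set.mem_inter_iff]
    constructor
    · intro hω
      obtain ⟨y, hy, hωy⟩ := hω.1
      have h' : ω ∈ openConnIn (⋃ n, (↑(S n) : Set V)) x y := by rwa [hSD]
      rw [openConnIn_iUnion_of_monotone hmonoS, Set.mem_iUnion] at h'
      obtain ⟨m, hm⟩ := h'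
      exact ⟨m, hω, y, hy, hm⟩
    · rintro ⟨m, hω, -⟩
      exact hω
  have hmonoE : Monotone fun m => E ∩ {ω | ∃ y, P₁ y ∧ ω ∈ openConnIn (↑(S m) : Set V) x y} := by
    rintro m n hmn ω ⟨hω, y, hy, hωy⟩
    exact ⟨hω, y, hy, openConnIn_mono (hmonoS hmn) x y hωy⟩
  have hL : Tendsto (fun m => μ (E ∩ {ω | ∃ y, P₁ y ∧ ω ∈ openConnIn (↑(S m) : Set V) x y}))
      atTop (𝓝 (μ E)) := by
    have h := tendsto_measure_iUnion_atTop (μ := μ) hmonoE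
    rwa [← hEU] at h
  -- comparison at each level `m`: on `E` the second arm avoids `C(ω) ⊇ C_m(ω)`
  have hstep : ∀ m, μ (E ∩ {ω | ∃ y, P₁ y ∧ ω ∈ openConnIn (↑(S m) : Set V) x y}) ≤
      ∫⁻ ω, Φ {v | ω ∈ openConnIn (↑(S m) : Set V) x v} ∂μ := by
    intro m
    have h2 := measure_arm_avoid_le_lintegral Gr p (S m) (hx m) x' P₁ P₂ hS hSD
    rw [← hμ] at h2
    rw [← lintegral_congr fun ω => hF (↑(S m)) ω]
    refine le_trans (measure_mono ?_) h2
    rintro ω ⟨⟨-, ⟨y, hy, hωy⟩, hne⟩, harm⟩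
    refine ⟨harm, y, hy, ?_⟩
    have havoid : PathIn (openGraph ω) (D \ {v | ω ∈ openConnIn D x v}) x' y :=
      pathIn_diff_of_forall (DCT16.pathIn_of_mem_openConnIn hωy) fun w hw hwC =>
        hne (mem_openConnIn_of_mem_of_mem hwC (DCT16.mem_openConnIn_of_pathIn hw))
    exact DCT16.mem_openConnIn_of_pathIn (havoid.mono (Set.sdiff_subset_sdiff_right
      fun v hv => openConnIn_mono (hsub m) x v hv))
  calc μ E ≤ ∫⁻ ω, Φ {v | ω ∈ openConnIn D x v} ∂μ := le_of_tendsto_of_tendsto' hL hR hstep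
    _ = _ := lintegral_congr fun ω => (hF D ω).symm

end StubDecoupling

open StubDecoupling in
/-- **Stub `stub_decoupling`** (stopping-set decoupling of the exploration of `C_ℍ(0)` at `p_c(ℤ³)`):
with `ℍ = {x | 0 ≤ x 0}`, `e = (0,1,0)` and `A(ω) = C_ℍ(0) = {v | 0 ⟷ v in ℍ}`,
`P(arm_ℍ(0,r), arm_ℍ(e,r), 0 ↮_ℍ e) ≤ ∫ 1{arm_ℍ(0,r)}(ω) · P(e reaches distance r inside ℍ ∖ A(ω)) dP(ω)`.
This is `measure_disjoint_arms_le_lintegral` for the half-boxes `ℍ ∩ B(m) ↑ ℍ`, the a.s. finiteness of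
`C_ℍ(0)` being Barsky–Grimmett–Newman (`ae_finite_openClusterIn_halfSpace_criticalProbI`). The guard
`1 ≤ r` is not used. -/
theorem stub_decoupling :
    ∀ r : ℕ, 1 ≤ r →
      (bondPercolation (zdGraph 3) (criticalProbI 3))
          {ω | (∃ y : Site 3, (∃ i : Fin 3, (r : ℤ) ≤ |y i|) ∧
                ω ∈ openConnIn {x : Site 3 | 0 ≤ x 0} 0 y) ∧
              (∃ y : Site 3, (∃ i : Fin 3, (r : ℤ) ≤ |y i - (Pi.single 1 1 : Site 3) i|) ∧
                ω ∈ openConnIn {x : Site 3 | 0 ≤ x 0} (Pi.single 1 1 : Site 3) y) ∧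
              ω ∉ openConnIn {x : Site 3 | 0 ≤ x 0} 0 (Pi.single 1 1 : Site 3)} ≤
        ∫⁻ ω, {ω : BondConfig (Site 3) | ∃ y : Site 3, (∃ i : Fin 3, (r : ℤ) ≤ |y i|) ∧
                  ω ∈ openConnIn {x : Site 3 | 0 ≤ x 0} 0 y}.indicator (fun _ => (1 : ℝ≥0∞)) ω *
              (bondPercolation (zdGraph 3) (criticalProbI 3))
                {ω' | ∃ y : Site 3, (∃ i : Fin 3, (r : ℤ) ≤ |y i - (Pi.single 1 1 : Site 3) i|) ∧
                  ω' ∈ openConnIn ({x : Site 3 | 0 ≤ x 0} \ {v | ω ∈ openConnIn {x : Site 3 | 0 ≤ x 0} 0 v})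
                    (Pi.single 1 1 : Site 3) y}
          ∂(bondPercolation (zdGraph 3) (criticalProbI 3)) := by
  classical
  intro r _
  -- the half-boxes `ℍ ∩ B(n)` exhaust `ℍ`
  let Sm : ℕ → Finset (Site 3) := fun n => (box 3 n).filter fun w => 0 ≤ w 0
  have hS : Monotone Sm := fun m n hmn => Finset.filter_subset_filter _ (box_mono 3 hmn)
  have hSD : ⋃ n, (↑(Sm n) : Set (Site 3)) = {x : Site 3 | 0 ≤ x 0} := by
    ext v
    simp only [Set.mem_iUnion, Sm, Finset.coe_filter, Set.mem_setOf_eq]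
    constructor
    · rintro ⟨n, -, hv⟩
      exact hv
    · intro hv
      obtain ⟨n, hn⟩ := Set.mem_iUnion.1 ((iUnion_coe_box 3).symm ▸ Set.mem_univ v)
      exact ⟨n, Finset.mem_coe.1 hn, hv⟩
  have hx : ∀ n, (0 : Site 3) ∈ Sm n := fun n => Finset.mem_filter.2 ⟨zero_mem_box 3 n, le_rfl⟩
  -- Barsky–Grimmett–Newman: the half-space cluster of `0` is a.s. finite
  have hfin : ∀ᵐ ω ∂(bondPercolation (zdGraph 3) (criticalProbI 3)),
      {v | ω ∈ openConnIn {x : Site 3 | 0 ≤ x 0} 0 v}.Finite := by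
    filter_upwards [ae_finite_openClusterIn_halfSpace_criticalProbI] with ω hω
    refine hω.subset fun v hv => ?_
    have hv' : ω ∈ openConnIn {x : Site 3 | 0 ≤ x 0} 0 v := hv
    rw [openConnIn_eq_openConnVia (Set.mem_setOf.mpr le_rfl : (0 : Site 3) ∈ {x : Site 3 | 0 ≤ x 0})]
      at hv'
    exact hv'
  exact measure_disjoint_arms_le_lintegral (zdGraph 3) (criticalProbI 3) hS hSD hx
    (Pi.single 1 1) (fun y => ∃ i : Fin 3, (r : ℤ) ≤ |y i|)
    (fun y => ∃ i : Fin 3, (r : ℤ) ≤ |y i - (Pi.single 1 1 : Site 3) i|) hfin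

end Summit.CriticalPhenomena.PercolationContinuityZ3.Theorems.BoundaryTwoArmDecay

end
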